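import Mathlib.AlgebraicTopology.FundamentalGroupoid.SimplyConnected
import Mathlib.AlgebraicTopology.FundamentalGroupoid.Basic
import Mathlib.Topology.Subpath
import Mathlib.Topology.UnitInterval
import Mathlib.Topology.Connected.PathConnected
import Mathlib.Analysis.Convex.Contractible
import Mathlib.Analysis.Normed.Module.Connected
import Mathlib.Geometry.Manifold.Instances.Sphere
import Literature.Topology.FourManifolds.HomotopyS4SimplyConnected
import HarnessLib

/-!
# Spheres of dimension at least two are simply connected

We prove `π₁(Sⁿ) = 1` for `n ≥ 2` (Hatcher, *Algebraic Topology*, Prop. 1.14) following the printed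
proof: the special case of van Kampen's theorem saying that a space covered by two open, simply
connected sets with path-connected intersection is simply connected (Hatcher, Lemma 1.15: every loop
at a basepoint of `U ∩ V` is homotopic to a product of loops each contained in `U` or in `V`, by a
Lebesgue-number subdivision of the loop), applied to the complements of two antipodal points of the
sphere, each homeomorphic to `ℝⁿ` by stereographic projection, whose intersection `≅ ℝⁿ ∖ {0}` is
path connected because `n ≥ 2`.

As a consequence we DISCHARGE the named fact `Literature.Topology.FourManifolds.simplyConnectedSpace_sphere_four`
(`HomotopyS4SimplyConnected.lean`).

## Main results

* `Literature.Topology.FourManifolds.Path.Homotopic.refl_of_isOpen_cover_two`: Hatcher's Lemma 1.15 in the form needed: if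
  `X = U ∪ V` with `U`, `V` open, loops at `x₀ ∈ U ∩ V` lying in `U` or in `V` are null-homotopic in
  `X`, and `U ∩ V` is path connected, then every loop at `x₀` is null-homotopic.
* `Literature.Topology.FourManifolds.simplyConnectedSpace_of_isOpen_union`: `X = U ∪ V`, `U`, `V` open and simply connected,
  `U ∩ V` path connected `⇒` `X` simply connected (Hatcher, Lemma 1.15 / van Kampen, easy half).
* `Literature.Topology.FourManifolds.simplyConnectedSpace_sphere`: the unit sphere of an `(n+1)`-dimensional real inner product
  space is simply connected for `2 ≤ n` (Hatcher, Prop. 1.14).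
* `Literature.Topology.FourManifolds.simplyConnectedSpace_sphere_four_holds`: discharge of `Literature.Topology.FourManifolds.simplyConnectedSpace_sphere_four`.

## References

* A. Hatcher, *Algebraic Topology*, Cambridge University Press (2002), §1.1, Prop. 1.14 and
  Lemma 1.15.
-/

noncomputable section

open Set Function unitInterval
open scoped Topology

namespace Literature.Topology.FourManifolds

/-! ### Two pieces of fundamental-groupoid algebra -/

section Algebra

variable {X : Type*} [TopologicalSpace X]

/-- If the loop `p · q⁻¹` is null-homotopic then `p ≃ q` (rel endpoints); groupoid algebra in the
fundamental groupoid (Hatcher, *Algebraic Topology*, §1.1). [folklore] -/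
theorem Path.Homotopic.of_trans_symm {x y : X} {p q : Path x y}
    (h : (p.trans q.symm).Homotopic (Path.refl x)) : p.Homotopic q := by
  rw [← Path.Homotopic.Quotient.eq] at h ⊢
  rw [Path.Homotopic.Quotient.mk_trans, Path.Homotopic.Quotient.mk_symm,
    Path.Homotopic.Quotient.mk_refl] at h
  calc Path.Homotopic.Quotient.mk p
      = Path.Homotopic.Quotient.trans
          (Path.Homotopic.Quotient.trans (Path.Homotopic.Quotient.mk p)
            (Path.Homotopic.Quotient.symm (Path.Homotopic.Quotient.mk q)))
          (Path.Homotopic.Quotient.mk q) := by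
        rw [Path.Homotopic.Quotient.trans_assoc, Path.Homotopic.Quotient.symm_trans,
          Path.Homotopic.Quotient.trans_refl]
    _ = Path.Homotopic.Quotient.mk q := by
        rw [h, Path.Homotopic.Quotient.refl_trans]

/-- Change of basepoint: if the conjugate `α · γ · α⁻¹` of a loop `γ` at `x` by a path `α` from `x₀`
to `x` is null-homotopic, so is `γ` (Hatcher, *Algebraic Topology*, Prop. 1.5). [folklore] -/
theorem Path.Homotopic.refl_of_conj {x₀ x : X} (α : Path x₀ x) {γ : Path x x}
    (h : ((α.trans γ).trans α.symm).Homotopic (Path.refl x₀)) : γ.Homotopic (Path.refl x) := by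
  rw [← Path.Homotopic.Quotient.eq] at h ⊢
  rw [Path.Homotopic.Quotient.mk_trans, Path.Homotopic.Quotient.mk_trans,
    Path.Homotopic.Quotient.mk_symm, Path.Homotopic.Quotient.mk_refl] at h
  rw [Path.Homotopic.Quotient.mk_refl]
  have h' := congrArg (fun δ => Path.Homotopic.Quotient.trans
    (Path.Homotopic.Quotient.symm (Path.Homotopic.Quotient.mk α))
    (Path.Homotopic.Quotient.trans δ (Path.Homotopic.Quotient.mk α))) h
  simp only [Path.Homotopic.Quotient.trans_assoc, Path.Homotopic.Quotient.symm_trans,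
    Path.Homotopic.Quotient.trans_refl, Path.Homotopic.Quotient.refl_trans] at h'
  rw [← Path.Homotopic.Quotient.trans_assoc, Path.Homotopic.Quotient.symm_trans,
    Path.Homotopic.Quotient.refl_trans] at h'
  exact h'

end Algebra

/-! ### Hatcher's Lemma 1.15: loops in a union of two open sets -/

section Union

variable {X : Type*} [TopologicalSpace X]

/-- **Hatcher's Lemma 1.15** (the part of van Kampen's theorem needed for `π₁(Sⁿ) = 1`), for a cover
by two open sets `S true`, `S false` indexed by `Bool`: if `x₀` lies in both, every loop at `x₀`
contained in one `S b` is null-homotopic in `X`, and every point of `S true ∩ S false` can be joined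
to `x₀` inside the intersection, then every loop `γ` at `x₀` is null-homotopic. Proof as printed:
choose a Lebesgue subdivision `0 = t₀ ≤ … ≤ tₘ = 1` with each `γ[tₖ, tₖ₊₁]` inside some `S b`
(`exists_monotone_Icc_subset_open_cover_unitInterval`) and show by induction on `k` that
`γ|[0, tₖ]` is homotopic to a path lying entirely in any `S b ∋ γ(tₖ)`, using the connecting paths
in the intersection at the break points (Hatcher, *Algebraic Topology*, Lemma 1.15 and proof of
Prop. 1.14). [cite: HatcherAT2002, Lemma 1.15] -/
theorem Path.Homotopic.refl_of_isOpen_cover_bool (S : Bool → Set X) (hS : ∀ b, IsOpen (S b))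
    (hcov : ∀ x, ∃ b, x ∈ S b) {x₀ : X} (hx₀ : ∀ b, x₀ ∈ S b)
    (hloop : ∀ b (δ : Path x₀ x₀), (∀ s, δ s ∈ S b) → δ.Homotopic (Path.refl x₀))
    (hmeet : ∀ y, (∀ b, y ∈ S b) → ∃ ε : Path x₀ y, ∀ b s, ε s ∈ S b)
    (γ : Path x₀ x₀) : γ.Homotopic (Path.refl x₀) := by
  obtain ⟨t, ht0, htmono, ⟨m, hm⟩, hsub⟩ :=
    exists_monotone_Icc_subset_open_cover_unitInterval (c := fun b => γ ⁻¹' S b)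
      (fun b => (hS b).preimage γ.continuous)
      (by
        intro s _
        obtain ⟨b, hb⟩ := hcov (γ s)
        exact mem_iUnion.2 ⟨b, hb⟩)
  -- the inductive invariant
  have key : ∀ k : ℕ, ∀ b, γ (t k) ∈ S b → ∃ β : Path x₀ (γ (t k)), (∀ s, β s ∈ S b) ∧
      ((γ.subpath 0 (t k)).cast γ.source.symm rfl).Homotopic β := by
    intro k
    induction k with
    | zero =>
      intro b _
      refine ⟨(γ.subpath 0 (t 0)).cast γ.source.symm rfl, ?_, Path.Homotopic.refl _⟩
      have h0 : ∀ s, γ.subpath 0 (t 0) s ∈ S b := by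
        rw [ht0]
        intro s
        rw [Path.subpath_self]
        simpa using hx₀ b
      exact h0
    | succ k ih =>
      intro b hb
      obtain ⟨b', hb'⟩ := hsub k
      have hk : γ (t k) ∈ S b' := hb' ⟨le_rfl, htmono k.le_succ⟩
      have hk1 : γ (t (k + 1)) ∈ S b' := hb' ⟨htmono k.le_succ, le_rfl⟩
      obtain ⟨β, hβS, hβ⟩ := ih b' hk
      -- extend `β` by the next piece of `γ`
      let β' : Path x₀ (γ (t (k + 1))) := β.trans (γ.subpath (t k) (t (k + 1)))
      have hβ'S : ∀ s, β' s ∈ S b' := by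
        intro s
        rw [Path.trans_apply]
        split_ifs with h
        · exact hβS _
        · have hmem : γ.subpath (t k) (t (k + 1)) ⟨2 * (s : ℝ) - 1, two_mul_sub_one_mem_iff.2
              ⟨(not_le.1 h).le, s.2.2⟩⟩ ∈ range (γ.subpath (t k) (t (k + 1))) := mem_range_self _
          rw [Path.range_subpath_of_le _ _ _ (htmono k.le_succ)] at hmem
          obtain ⟨u, hu, hu'⟩ := hmem
          rw [← hu']
          exact hb' hu
      have hβ' : ((γ.subpath 0 (t (k + 1))).cast γ.source.symm rfl).Homotopic β' := by
        have h1 : ((γ.subpath 0 (t (k + 1))).cast γ.source.symm rfl).Homotopic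
            (((γ.subpath 0 (t k)).trans (γ.subpath (t k) (t (k + 1)))).cast γ.source.symm rfl) :=
          Path.Homotopic.pathCast ⟨(Path.Homotopy.subpathTransSubpath γ 0 (t k) (t (k + 1))).symm⟩
            _ _
        have h2 : ((γ.subpath 0 (t k)).trans (γ.subpath (t k) (t (k + 1)))).cast γ.source.symm rfl =
            ((γ.subpath 0 (t k)).cast γ.source.symm rfl).trans (γ.subpath (t k) (t (k + 1))) := by
          ext s
          rfl
        rw [h2] at h1
        exact h1.trans (hβ.hcomp (Path.Homotopic.refl _))
      by_cases hbb : b = b'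
      · subst hbb
        exact ⟨β', hβ'S, hβ'⟩
      · -- the break point lies in both sets: reroute through the intersection
        have hall : ∀ b'', γ (t (k + 1)) ∈ S b'' := by
          intro b''
          by_cases h : b'' = b'
          · rw [h]; exact hk1
          · have : b'' = b := by
              cases b <;> cases b' <;> cases b'' <;> simp_all
            rw [this]; exact hb
        obtain ⟨ε, hε⟩ := hmeet _ hall
        have hloopS : ∀ s, (β'.trans ε.symm) s ∈ S b' := by
          intro s
          rw [Path.trans_apply]
          split_ifs with h
          · exact hβ'S _
          · rw [Path.symm_apply]
            exact hε b' _
        have hnull := hloop b' _ hloopS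
        exact ⟨ε, hε b, hβ'.trans (Path.Homotopic.of_trans_symm hnull)⟩
  -- conclude at `k = m`, where `t m = 1`
  have htm : t m = 1 := hm m le_rfl
  have hγm : γ (t m) = x₀ := by rw [htm]; exact γ.target
  have hmemS : γ (t m) ∈ S true := by rw [hγm]; exact hx₀ true
  obtain ⟨β, hβS, hβ⟩ := key m true hmemS
  have hP : (((γ.subpath 0 (t m)).cast γ.source.symm rfl).cast rfl hγm.symm : Path x₀ x₀) = γ := by
    have h01 : ∀ s, γ.subpath 0 (t m) s = γ s := by
      rw [htm]
      intro s
      simp [Path.subpath]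
    ext s
    exact h01 s
  have h1 : γ.Homotopic (β.cast rfl hγm.symm) := by
    have h := hβ.pathCast rfl hγm.symm
    rw [hP] at h
    exact h
  exact h1.trans (hloop true _ fun s => hβS s)

/-- **Hatcher's Lemma 1.15**, two-set form: if `X = U ∪ V` with `U`, `V` open, `x₀ ∈ U ∩ V`, every
loop at `x₀` inside `U` and every loop at `x₀` inside `V` is null-homotopic in `X`, and `U ∩ V` is
path connected, then every loop at `x₀` is null-homotopic (Hatcher, *Algebraic Topology*,
Lemma 1.15). [cite: HatcherAT2002, Lemma 1.15] -/
theorem Path.Homotopic.refl_of_isOpen_cover_two {U V : Set X} (hU : IsOpen U) (hV : IsOpen V)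
    (hUV : U ∪ V = univ) {x₀ : X} (hxU : x₀ ∈ U) (hxV : x₀ ∈ V)
    (hloopU : ∀ δ : Path x₀ x₀, (∀ s, δ s ∈ U) → δ.Homotopic (Path.refl x₀))
    (hloopV : ∀ δ : Path x₀ x₀, (∀ s, δ s ∈ V) → δ.Homotopic (Path.refl x₀))
    (hmeet : IsPathConnected (U ∩ V)) (γ : Path x₀ x₀) : γ.Homotopic (Path.refl x₀) := by
  refine Path.Homotopic.refl_of_isOpen_cover_bool (fun b => cond b U V) ?_ ?_ ?_ ?_ ?_ γ
  · intro b; cases b <;> assumption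
  · intro x
    have hx : x ∈ U ∪ V := by rw [hUV]; exact mem_univ x
    rcases hx with h | h
    · exact ⟨true, h⟩
    · exact ⟨false, h⟩
  · intro b; cases b <;> assumption
  · intro b; cases b
    · exact hloopV
    · exact hloopU
  · intro y hy
    have hyUV : y ∈ U ∩ V := ⟨hy true, hy false⟩
    have hj := hmeet.joinedIn x₀ ⟨hxU, hxV⟩ y hyUV
    refine ⟨hj.somePath, fun b s => ?_⟩
    cases b
    · exact (hj.somePath_mem s).2
    · exact (hj.somePath_mem s).1

/-- **Van Kampen, easy half** (Hatcher, *Algebraic Topology*, Lemma 1.15 and the deduction of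
Prop. 1.14): if `X = U ∪ V` with `U`, `V` open and simply connected and `U ∩ V` path connected
(in particular nonempty), then `X` is simply connected. [cite: HatcherAT2002, Lemma 1.15] -/
theorem simplyConnectedSpace_of_isOpen_union {U V : Set X} (hU : IsOpen U) (hV : IsOpen V)
    (hUV : U ∪ V = univ) (hUsc : IsSimplyConnected U) (hVsc : IsSimplyConnected V)
    (hmeet : IsPathConnected (U ∩ V)) : SimplyConnectedSpace X := by
  obtain ⟨x₀, hxU, hxV⟩ := hmeet.nonempty
  have hpc : IsPathConnected (univ : Set X) := by
    rw [← hUV]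
    exact hUsc.isPathConnected.union hVsc.isPathConnected ⟨x₀, hxU, hxV⟩
  haveI : PathConnectedSpace X := pathConnectedSpace_iff_univ.mpr hpc
  have hloop : ∀ {W : Set X}, IsSimplyConnected W → ∀ δ : Path x₀ x₀, (∀ s, δ s ∈ W) →
      δ.Homotopic (Path.refl x₀) := by
    intro W hW δ hδ
    obtain ⟨F, -⟩ := (isSimplyConnected_iff_exists_homotopy_refl_forall_mem.mp hW).2 x₀ δ hδ
    exact ⟨F⟩
  rw [simply_connected_iff_loops_nullhomotopic]
  refine ⟨inferInstance, fun x γ => ?_⟩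
  have α : Path x₀ x := (hpc.joinedIn x₀ (mem_univ _) x (mem_univ _)).somePath
  exact Path.Homotopic.refl_of_conj α
    (Path.Homotopic.refl_of_isOpen_cover_two hU hV hUV hxU hxV (hloop hUsc) (hloop hVsc) hmeet _)

end Union

/-! ### Spheres -/

section Sphere

open Metric Module

variable {E : Type*} [NormedAddCommGroup E] [InnerProductSpace ℝ E]

/-- The stereographic chart `stereographic' n v` (projection from `v`) sends the antipode `-v` to the
origin. [folklore] -/
theorem stereographic'_apply_neg {n : ℕ} [Fact (finrank ℝ E = n + 1)] (v : sphere (0 : E) 1) :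
    stereographic' n v (-v) = 0 := by
  simp only [stereographic', OpenPartialHomeomorph.coe_trans, comp_apply,
    Homeomorph.toOpenPartialHomeomorph_apply, LinearIsometryEquiv.coe_toHomeomorph,
    stereographic_apply_neg, map_zero]

/-- The complement of a point `v` of the unit sphere `Sⁿ ⊂ E` (`dim E = n + 1`) is simply connected:
stereographic projection from `v` is a homeomorphism onto `ℝⁿ`, which is contractible
(Hatcher, *Algebraic Topology*, proof of Prop. 1.14). [folklore] -/
theorem isSimplyConnected_compl_singleton_sphere {n : ℕ} [Fact (finrank ℝ E = n + 1)]
    (v : sphere (0 : E) 1) : IsSimplyConnected ({v}ᶜ : Set (sphere (0 : E) 1)) := by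
  have e : ((stereographic' n v).source) ≃ₜ EuclideanSpace ℝ (Fin n) :=
    (stereographic' n v).toHomeomorphSourceTarget.trans
      ((Homeomorph.setCongr (stereographic'_target v)).trans (Homeomorph.Set.univ _))
  have h : IsSimplyConnected ((stereographic' n v).source) := e.toHomotopyEquiv.simplyConnectedSpace
  rwa [stereographic'_source] at h

/-- The complement of two antipodal points `v`, `-v` of the unit sphere `Sⁿ ⊂ E` (`dim E = n + 1`,
`n ≥ 2`) is path connected: under stereographic projection from `v` it is `ℝⁿ ∖ {0}`
(Hatcher, *Algebraic Topology*, proof of Prop. 1.14: "`Sⁿ` minus two points is path connected for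
`n ≥ 2`"). [folklore] -/
theorem isPathConnected_compl_pair_sphere {n : ℕ} [Fact (finrank ℝ E = n + 1)] (hn : 2 ≤ n)
    (v : sphere (0 : E) 1) :
    IsPathConnected (({v}ᶜ ∩ {-v}ᶜ : Set (sphere (0 : E) 1))) := by
  set st := stereographic' n v with hst
  have hrank : 1 < Module.rank ℝ (EuclideanSpace ℝ (Fin n)) := by
    rw [← Module.finrank_eq_rank, finrank_euclideanSpace_fin]
    exact_mod_cast hn
  have h0 : IsPathConnected ({0}ᶜ : Set (EuclideanSpace ℝ (Fin n))) :=
    isPathConnected_compl_singleton_of_one_lt_rank hrank 0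
  have hcont : ContinuousOn st.symm ({0}ᶜ : Set (EuclideanSpace ℝ (Fin n))) :=
    st.continuousOn_symm.mono (by rw [hst, stereographic'_target]; exact subset_univ _)
  have himage := h0.image' hcont
  have hvsrc : -v ∈ st.source := by
    rw [hst, stereographic'_source, mem_compl_singleton_iff]
    exact (ne_neg_of_mem_unit_sphere ℝ v).symm
  have hneg : st (-v) = 0 := stereographic'_apply_neg v
  convert himage using 1
  ext x
  constructor
  · rintro ⟨hxv, hxnv⟩
    have hxsrc : x ∈ st.source := by rw [hst, stereographic'_source]; exact hxv
    refine ⟨st x, ?_, st.left_inv hxsrc⟩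
    intro hx0
    apply hxnv
    rw [mem_singleton_iff]
    exact st.injOn hxsrc hvsrc (hx0.trans hneg.symm)
  · rintro ⟨y, hy, rfl⟩
    have hyt : y ∈ st.target := by rw [hst, stereographic'_target]; exact mem_univ y
    refine ⟨?_, ?_⟩
    · have := st.map_target hyt
      rw [hst, stereographic'_source] at this
      exact this
    · intro h
      rw [mem_singleton_iff] at h
      apply hy
      rw [mem_singleton_iff, ← st.right_inv hyt, h, hneg]

/-- **`π₁(Sⁿ) = 1` for `n ≥ 2`** (Hatcher, *Algebraic Topology*, Prop. 1.14): the unit sphere of an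
`(n+1)`-dimensional real inner product space is simply connected when `2 ≤ n`. Proof as printed:
cover `Sⁿ` by the complements of two antipodal points, each homeomorphic to `ℝⁿ` (stereographic
projection) hence simply connected, with intersection `≅ ℝⁿ ∖ {0}` path connected as `n ≥ 2`, and
apply Lemma 1.15 (`Literature.Topology.FourManifolds.simplyConnectedSpace_of_isOpen_union`). [cite: HatcherAT2002, Prop. 1.14] -/
theorem simplyConnectedSpace_sphere {n : ℕ} [Fact (finrank ℝ E = n + 1)] (hn : 2 ≤ n) :
    SimplyConnectedSpace (sphere (0 : E) 1) := by
  haveI : Nontrivial E := Module.nontrivial_of_finrank_pos (R := ℝ)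
    (by rw [(Fact.out : finrank ℝ E = n + 1)]; exact Nat.succ_pos n)
  obtain ⟨v₀, hv₀⟩ := (NormedSpace.sphere_nonempty (E := E) (x := (0 : E)) (r := 1)).mpr zero_le_one
  let v : sphere (0 : E) 1 := ⟨v₀, hv₀⟩
  refine simplyConnectedSpace_of_isOpen_union (U := ({v}ᶜ : Set (sphere (0 : E) 1)))
    (V := ({-v}ᶜ : Set (sphere (0 : E) 1))) isOpen_compl_singleton isOpen_compl_singleton ?_
    (isSimplyConnected_compl_singleton_sphere (n := n) v)
    (isSimplyConnected_compl_singleton_sphere (n := n) (-v))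
    (isPathConnected_compl_pair_sphere hn v)
  ext x
  simp only [mem_union, mem_compl_iff, mem_singleton_iff, mem_univ, iff_true]
  by_contra h
  rw [not_or, not_not, not_not] at h
  exact ne_neg_of_mem_unit_sphere ℝ v (h.1.symm.trans h.2)

/-- `π₁(Sⁿ) = 1`, `n ≥ 2`, for the standard sphere in `EuclideanSpace ℝ (Fin (n + 1))`
(Hatcher, *Algebraic Topology*, Prop. 1.14). [cite: HatcherAT2002, Prop. 1.14] -/
theorem simplyConnectedSpace_euclideanSphere {n : ℕ} (hn : 2 ≤ n) :
    SimplyConnectedSpace (sphere (0 : EuclideanSpace ℝ (Fin (n + 1))) 1) :=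
  haveI := Fact.mk (@finrank_euclideanSpace_fin ℝ _ (n + 1))
  simplyConnectedSpace_sphere hn

/-- **Discharge** of the named fact `Literature.Topology.FourManifolds.simplyConnectedSpace_sphere_four`: the standard `S⁴ ⊂ ℝ⁵`
is simply connected (Hatcher, *Algebraic Topology*, Prop. 1.14 with `n = 4`).
[cite: HatcherAT2002, Prop. 1.14] -/
theorem simplyConnectedSpace_sphere_four_holds : simplyConnectedSpace_sphere_four :=
  simplyConnectedSpace_euclideanSphere (n := 4) (by norm_num)

end Sphere

end Literature.Topology.FourManifolds

end
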